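import Summits.CriticalPhenomena.PercolationContinuityZ3.Theorems.Transplant.SkelKits
import Summits.CriticalPhenomena.PercolationContinuityZ3.Theorems.Transplant.SkelStepIVInputs
import Summits.CriticalPhenomena.PercolationContinuityZ3.Theorems.Transplant.KNLevelsStepIV
import Summits.CriticalPhenomena.PercolationContinuityZ3.Theorems.Transplant.SkelCubeAt
import Summits.CriticalPhenomena.PercolationContinuityZ3.Theorems.Transplant.BoxProdZ2KitStepIV
import HarnessLib

/-!
# L5.15 part 2 (hp-8 g24): the generic KIT CLAUSE with a free input margin — `SkelI.kitClause'`

builds on p205010 (kernel theorem, internal audit signed; external expert review pending) — nothing in this file uses p205010.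
Lane `prim-bschramm`, typed by the `prim-hp-8` lineage (gen 24) from p1-g7's LANDED `SkelKits.kitClause` (L5.9, p237686): the same statement
and proof with the Step-I input family `hin` and the guard of the route branch of the per-contact dichotomy `hcon` at a free margin
`am ≤ δ²` (the representative's inputs at the cube centre are then known at margin `am`, which the face step's (nA+1)-step inner route
needs for its first hop; Step IV itself still runs at margin `δ²`).  Helper file (`--supports stmt-CriticalPhenomena-4575 --as helper`);
binder form.  Consumers: `SkelI.hcon_win₂'` / `hcon_win₂_of_room'` (SkelConcKits) produce exactly this `hcon`.
[cite: KozmaNitzan2024, §4 Lemma 10, Steps III–V (pp. 19–22)] [cite: GrimmettPercolation1999, §7.2]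
-/

noncomputable section

open MeasureTheory
open scoped Classical

namespace Summit.CriticalPhenomena.PercolationContinuityZ3.Theorems

namespace Transplant

namespace SkelI

open Literature.Probability.Percolation Literature.Probability.LatticeModels SimpleGraph KNLevels KozmaNitzan
open Literature.Probability.Percolation.GM (HOct)
open Literature.Barriers.CriticalPhenomena (graphBall graphBall_finite mem_graphBall_self graphBall_mono)
open Skel (winGraph winGraph_adj winGraph_le winLevel mem_winLevel_iff winLData winLData_X inNbr KitGeom fatSeq macroPiece fatRadius
  cubeCtr cubeFace)

variable {V : Type} [DecidableEq V] {G : SimpleGraph V} [G.LocallyFinite] (Φ : PlanarSkeletonConc G)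

/-! ## The kit clause with a free input margin -/

/-- **The kit clause with a free INPUT MARGIN `am ≤ δ²`** (verbatim p1-g7's `SkelI.kitClause` with `hin` and the guard of the route branch of `hcon`
at margin `am`): the face step's inner chain needs its first-hop link input finer than `δ²` (hp-8 g24 INBOX 2026-08-20T22:05Z).
Exploration graph `winGraph G w₀ R`.
[cite: KozmaNitzan2024, §4 Lemma 10, Steps III–IV (pp. 19–21)] -/
theorem kitClause' [Countable V] {p : unitInterval} (hC : Φ.toPlanarSkeleton.CylSubcritical p) (msel : V → ℕ) {Ssc : Finset ℕ}
    {q : unitInterval} {δ : ℝ} (hδ : 0 < δ) {am : ℝ} (ham : am ≤ δ ^ 2)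
    (hin : ∀ i ∈ Skel.inputIndex Φ Ssc, 1 - am < (bondPercolation G q).real (Skel.inputEvent Φ hC msel i))
    {M : ℕ} (hM : M ∈ Ssc) (hmsel : ∀ t ∈ Φ.types, msel t ≤ M)
    -- the window level and the slab constants
    {w₀ : V} {R : ℕ} {lo hi : Site 2} {j ℓs R' r₀ rs : ℕ} (hℓs : 1 ≤ ℓs)
    (hwide : ∀ i, (lo - (j : Site 2)) i + 2 * tanOff ℓs M ≤ (hi + (j : Site 2)) i)
    (hR' : ∀ c : V, graphBall G c (ℓs + 2 + 2 * tanOff ℓs M) ∩ Φ.toPlanarSkeleton.cyl c ℓs ⊆ Φ.cylBall c ℓs R')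
    (hr₀ : ℓs + 1 + tanOff ℓs M + R' ≤ r₀) (hR : r₀ ≤ R) (hrs : ℓs + 2 + tanOff ℓs M + R' ≤ rs)
    {Unear : V → Finset V} {cU : ℕ} (hU : NearFaceOKDeep Φ w₀ R lo hi j ℓs M R' r₀ rs cU Unear)
    (hUdef : ∀ x ∈ outerBoundary (winGraph G w₀ R) (winLevel Φ w₀ R lo hi j),
      inNbr Φ w₀ R (Finset.Icc (lo - (j : Site 2)) (hi + (j : Site 2))) x ∈ graphBall G w₀ (R - r₀) →
      Unear x = cubeFace Φ hC (deepCtr Φ w₀ R (lo - (j : Site 2)) (hi + (j : Site 2)) ℓs M x) (exitDir Φ w₀ R (lo - (j : Site 2)) (hi + (j : Site 2)) x).1 (exitDir Φ w₀ R (lo - (j : Site 2)) (hi + (j : Site 2)) x).2 ℓs M)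
    -- ROOM: faces in the shell box; cubes of near contacts in the shell window, faces on their window-graph inner boundary
    (hUsh : ∀ x ∈ outerBoundary (winGraph G w₀ R) (winLevel Φ w₀ R lo hi j),
      ∀ u ∈ Unear x,
        Φ.φ u ∈ Finset.Icc ((lo - (j : Site 2)) + ((2 * ℓs + 2 : ℕ) : Site 2)) ((hi + (j : Site 2)) - ((2 * ℓs + 2 : ℕ) : Site 2)))
    (hcube : ∀ x ∈ outerBoundary (winGraph G w₀ R) (winLevel Φ w₀ R lo hi j), inNbr Φ w₀ R (Finset.Icc (lo - (j : Site 2)) (hi + (j : Site 2))) x ∈ graphBall G w₀ (R - r₀) →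
      fatSeq Φ hC (cubeCtr Φ (deepCtr Φ w₀ R (lo - (j : Site 2)) (hi + (j : Site 2)) ℓs M x) (exitDir Φ w₀ R (lo - (j : Site 2)) (hi + (j : Site 2)) x).1 (exitDir Φ w₀ R (lo - (j : Site 2)) (hi + (j : Site 2)) x).2 ℓs M) M ⊆
        Φ.Win w₀ (Finset.Icc ((lo - (j : Site 2)) + ((2 * ℓs + 2 : ℕ) : Site 2)) ((hi + (j : Site 2)) - ((2 * ℓs + 2 : ℕ) : Site 2))) R ∧
      Unear x ⊆ innerBoundary (winGraph G w₀ R)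
          (fatSeq Φ hC (cubeCtr Φ (deepCtr Φ w₀ R (lo - (j : Site 2)) (hi + (j : Site 2)) ℓs M x) (exitDir Φ w₀ R (lo - (j : Site 2)) (hi + (j : Site 2)) x).1 (exitDir Φ w₀ R (lo - (j : Site 2)) (hi + (j : Site 2)) x).2 ℓs M) M))
    -- the level's source/support, the weighting, the region and the target
    (k : ℕ) (o : V) (Sfin : Finset V) {Wt : Sym2 V → unitInterval} {D T : Finset V}
    (hWD : IsSubbox (winGraph G w₀ R) Wt q D) (hXD : winLevel Φ w₀ R lo hi j ⊆ D) {N : ℕ}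
    (hN : k * (Φ.Δ + 1) ^ (2 * rs) ≤ N)
    (hk : (1 - (q : ℝ) ^ (1 + Φ.Δ * ((Φ.Δ + 1) ^ R' + (tanOff ℓs M + 2)) +
      ((Φ.Δ + 1) ^ R' + (tanOff ℓs M + 2)) * cU)) ^ k ≤ δ)
    -- the per-contact dichotomy: a face vertex in the target, or (near contact) the ROUTE HYPOTHESIS of `Skel.kit_hIV_of_route`
    -- (for every representative `t` carrying the inputs at the cube centre: a linked target piece `Ft ⊆ T` inside `Qt ⊆ D` off the cube)
    (hcon : ∀ x ∈ outerBoundary (winGraph G w₀ R) (winLevel Φ w₀ R lo hi j),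
      (∃ u ∈ (slabGeomDeep Φ w₀ R lo hi j ℓs M R' r₀ Unear).U x, u ∈ T) ∨
      (inNbr Φ w₀ R (Finset.Icc (lo - (j : Site 2)) (hi + (j : Site 2))) x ∈ graphBall G w₀ (R - r₀) ∧ ∀ t ∈ Φ.types,
        (∀ M' ∈ Ssc, 1 - am < (bondPercolation G q).real (UniqZone.zone G (fatSeq Φ hC (cubeCtr Φ (deepCtr Φ w₀ R (lo - (j : Site 2)) (hi + (j : Site 2)) ℓs M x) (exitDir Φ w₀ R (lo - (j : Site 2)) (hi + (j : Site 2)) x).1 (exitDir Φ w₀ R (lo - (j : Site 2)) (hi + (j : Site 2)) x).2 ℓs M)) (msel t) M') ∧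
          ∀ g' : HOct 2, 1 - am < (bondPercolation G q).real
            (linkIn (↑(fatSeq Φ hC (cubeCtr Φ (deepCtr Φ w₀ R (lo - (j : Site 2)) (hi + (j : Site 2)) ℓs M x) (exitDir Φ w₀ R (lo - (j : Site 2)) (hi + (j : Site 2)) x).1 (exitDir Φ w₀ R (lo - (j : Site 2)) (hi + (j : Site 2)) x).2 ℓs M) M')) (fatSeq Φ hC (cubeCtr Φ (deepCtr Φ w₀ R (lo - (j : Site 2)) (hi + (j : Site 2)) ℓs M x) (exitDir Φ w₀ R (lo - (j : Site 2)) (hi + (j : Site 2)) x).1 (exitDir Φ w₀ R (lo - (j : Site 2)) (hi + (j : Site 2)) x).2 ℓs M) (msel t)) (macroPiece Φ (cubeCtr Φ (deepCtr Φ w₀ R (lo - (j : Site 2)) (hi + (j : Site 2)) ℓs M x) (exitDir Φ w₀ R (lo - (j : Site 2)) (hi + (j : Site 2)) x).1 (exitDir Φ w₀ R (lo - (j : Site 2)) (hi + (j : Site 2)) x).2 ℓs M) M' (fatRadius Φ hC M') g'))) →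
        ∃ Qt Ft : Finset V, Ft ⊆ T ∧ Qt ⊆ D ∧ (∀ u ∈ Qt, ∀ v ∈ Qt, G.Adj u v → (winGraph G w₀ R).Adj u v) ∧
          Disjoint Ft (fatSeq Φ hC (cubeCtr Φ (deepCtr Φ w₀ R (lo - (j : Site 2)) (hi + (j : Site 2)) ℓs M x) (exitDir Φ w₀ R (lo - (j : Site 2)) (hi + (j : Site 2)) x).1 (exitDir Φ w₀ R (lo - (j : Site 2)) (hi + (j : Site 2)) x).2 ℓs M) M) ∧
          1 - δ ^ 2 < (prodBernoulli Wt).real (linkIn (↑Qt) (fatSeq Φ hC (cubeCtr Φ (deepCtr Φ w₀ R (lo - (j : Site 2)) (hi + (j : Site 2)) ℓs M x) (exitDir Φ w₀ R (lo - (j : Site 2)) (hi + (j : Site 2)) x).1 (exitDir Φ w₀ R (lo - (j : Site 2)) (hi + (j : Site 2)) x).2 ℓs M) (msel t)) Ft))) :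
    ∃ (σ : SData V) (S : Finset V), SHyp (winLData Φ w₀ R lo hi o Sfin) j σ ∧ σ.N ≤ N ∧
      (1 - (q : ℝ) ^ σ.sB) ^ σ.k ≤ δ ∧ S ⊆ (winLData Φ w₀ R lo hi o Sfin).X j ∧ S ⊆ D ∧
      (∀ x ∈ σ.K, ∀ e ∈ σ.seed x, e ∉ wireSet (↑S : Set V)) ∧ (∀ x ∈ σ.K, σ.face x ⊆ S) ∧
      (∀ x ∈ σ.K, 1 - 3 * δ ≤ (prodBernoulli Wt).real {ω | ∃ u ∈ σ.face x,
        1 - δ < (prodBernoulli (pinW Wt (wireSet (↑S : Set V)) ω)).real (⋃ t ∈ T, openConnIn (↑D : Set V) u t)}) := by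
  set κ := slabGeomDeep Φ w₀ R lo hi j ℓs M R' r₀ Unear with hκ
  set Spin := pinSet Φ w₀ R lo hi j ℓs r₀ with hSpin
  have hOK := kitOK_slabDeep Φ hwide hR' hr₀ hR hrs hU
  have hSX : Spin ⊆ winLevel Φ w₀ R lo hi j := pinSet_subset_winLevel Φ w₀ R lo hi j ℓs r₀
  have hSD : Spin ⊆ D := hSX.trans hXD
  -- faces lie in the pinning set
  have hface : ∀ x ∈ outerBoundary (winGraph G w₀ R) (winLevel Φ w₀ R lo hi j), κ.U x ⊆ Spin := by
    intro x hx u hu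
    simp only [hκ, slabGeomDeep] at hu
    rw [hSpin, pinSet, Finset.mem_union]
    split_ifs at hu with hnear
    · left
      rw [Φ.mem_Win]
      exact ⟨((mem_winLevel_iff Φ).1 (hU.sub x hx hnear hu)).1, hUsh x hx u hu⟩
    · right
      rw [Finset.mem_singleton] at hu
      rw [hu, Finset.mem_image]
      exact ⟨x, Finset.mem_filter.2 ⟨hx, hnear⟩, rfl⟩
  refine ⟨kitSData Φ w₀ R lo hi j κ rs ((Φ.Δ + 1) ^ R' + (tanOff ℓs M + 2)) cU k, Spin,
    shyp_kit hOK o Sfin k, hN, hk, by rw [winLData_X]; exact hSX, hSD, fun x hx e he => ?_, fun x hx => ?_, fun x hx => ?_⟩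
  · -- seeds avoid the pairs of the pinning set
    rw [kitSData_K] at hx
    rw [kitSData_seed] at he
    exact slabSeedDeep_notMem_wireSet Φ hℓs hwide hUsh hx (pinSet_spec Φ w₀ R lo hi j ℓs r₀) he
  · rw [kitSData_K] at hx; rw [kitSData_face]; exact hface x hx
  · -- Step IV: edge contacts by the face-in-target shortcut, near contacts by `kit_hIV_of_le`
    rw [kitSData_K] at hx
    rw [kitSData_face]
    rcases hcon x hx with ⟨u, hu, huT⟩ | ⟨hnear, hroute⟩
    · exact hIV_of_mem_face hδ hu huT (hSD (hface x hx hu))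
    · have hUx : κ.U x = Unear x := by simp only [hκ, slabGeomDeep, if_pos hnear]
      rw [hUx]
      obtain ⟨hcS, hcib⟩ := hcube x hx hnear
      have hcS' : fatSeq Φ hC (cubeCtr Φ (deepCtr Φ w₀ R (lo - (j : Site 2)) (hi + (j : Site 2)) ℓs M x) (exitDir Φ w₀ R (lo - (j : Site 2)) (hi + (j : Site 2)) x).1 (exitDir Φ w₀ R (lo - (j : Site 2)) (hi + (j : Site 2)) x).2 ℓs M) M ⊆ Spin := fun v hv => by rw [hSpin, pinSet]; exact Finset.mem_union_left _ (hcS hv)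
      have hcR : ∀ v ∈ fatSeq Φ hC (cubeCtr Φ (deepCtr Φ w₀ R (lo - (j : Site 2)) (hi + (j : Site 2)) ℓs M x) (exitDir Φ w₀ R (lo - (j : Site 2)) (hi + (j : Site 2)) x).1 (exitDir Φ w₀ R (lo - (j : Site 2)) (hi + (j : Site 2)) x).2 ℓs M) M, v ∈ graphBall G w₀ R := fun v hv => (Φ.mem_Win.1 (hcS hv)).1
      have hUg : Unear x = macroPiece Φ (cubeCtr Φ (deepCtr Φ w₀ R (lo - (j : Site 2)) (hi + (j : Site 2)) ℓs M x) (exitDir Φ w₀ R (lo - (j : Site 2)) (hi + (j : Site 2)) x).1 (exitDir Φ w₀ R (lo - (j : Site 2)) (hi + (j : Site 2)) x).2 ℓs M) M (fatRadius Φ hC M) (Skel.faceElt (exitDir Φ w₀ R (lo - (j : Site 2)) (hi + (j : Site 2)) x).1 (exitDir Φ w₀ R (lo - (j : Site 2)) (hi + (j : Site 2)) x).2) := by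
        rw [hUdef x hx hnear, Skel.cubeFace]
      -- Step IV (the body of `Skel.kit_hIV_of_route`, instance-polymorphically): p3-g4's input package + `KNLevels.stepIV_in`
      obtain ⟨t, ht, hall⟩ := Skel.exists_inputs_at_center_all Φ hC msel hin (cubeCtr Φ (deepCtr Φ w₀ R (lo - (j : Site 2)) (hi + (j : Site 2)) ℓs M x) (exitDir Φ w₀ R (lo - (j : Site 2)) (hi + (j : Site 2)) x).1 (exitDir Φ w₀ R (lo - (j : Site 2)) (hi + (j : Site 2)) x).2 ℓs M)
      obtain ⟨h1, h2⟩ := Skel.inputs_at_center_of_le Φ hC (winGraph_le G w₀ R) hWD (hcS'.trans hSD)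
        (Skel.adj_winGraph_of_subset_graphBall hcR)
        ((sub_le_sub_left ham 1).trans_lt (hall M hM).1)
        (fun g' => (sub_le_sub_left ham 1).trans_lt ((hall M hM).2 g'))
      obtain ⟨Qt, Ft, hFT, hQD, -, hdisj, h3⟩ := hroute t ht hall
      have hkn := Skel.fatSeq_monotone Φ hC (cubeCtr Φ (deepCtr Φ w₀ R (lo - (j : Site 2)) (hi + (j : Site 2)) ℓs M x) (exitDir Φ w₀ R (lo - (j : Site 2)) (hi + (j : Site 2)) x).1 (exitDir Φ w₀ R (lo - (j : Site 2)) (hi + (j : Site 2)) x).2 ℓs M) (hmsel t ht)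
      have h2' := h2 (Skel.faceElt (exitDir Φ w₀ R (lo - (j : Site 2)) (hi + (j : Site 2)) x).1 (exitDir Φ w₀ R (lo - (j : Site 2)) (hi + (j : Site 2)) x).2)
      rw [← hUg] at h2'
      exact stepIV_in (G := winGraph G w₀ R) (S := Spin) hWD hFT hQD _ hkn hcS' hcib hdisj hδ (Rg := (↑D : Set V))
        (Finset.coe_subset.2 (hcS'.trans hSD)) (Finset.coe_subset.2 hQD) h1 h2' h3

end SkelI

end Transplant

end Summit.CriticalPhenomena.PercolationContinuityZ3.Theorems

end
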